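import Literature.MathematicalPhysics.QuantumFieldTheory.Balaban1983to89.B9Eq349DPBlockDecayLetters
import Literature.MathematicalPhysics.QuantumFieldTheory.Balaban1983to89.B9Eq349GreenPerturbedBlockDecay
import Literature.MathematicalPhysics.QuantumFieldTheory.Balaban1983to89.B9Eq349ConjugatedGreenBlockDecay
import Literature.MathematicalPhysics.QuantumFieldTheory.Balaban1983to89.B9Eq349PerturbedQGGQInvBlockDecay

/-!
# `Balaban1983to89.B9Eq349DPBlockDecayWindow` — T. Bałaban, *Propagators for lattice gauge theories in a background field*, Commun. Math. Phys.
# **99** (1985) 389–434 [Balaban1985BackgroundPropagators] (3.49) p. 399 with Thm 3.11 p. 416, (3.25)–(3.26) pp. 394–395 and (3.101)–(3.104) p. 414: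
# **ROW L9 AT A GENERAL BACKGROUND OF THE WINDOW `‖U − 1‖ ≤ ε_U`, κ₁-FREE, UNIFORM IN THE VOLUME — `∃ C` (then `∃ k`) BEFORE the volume and the
# background such that `‖1_{Δ(y₁)} ∘ D_U(1 − R(U)) ∘ 1_{Δ(y₀)}‖ ≤ C·e^{−(κ∕8)·d_m(y₀,y₁)}` for every pair of fine blocks, and (K4b) §3∕§4's
# double-commutator ∕ (up)-row bounds for `T(U) = D_U(1 − R(U))`, from SCALAR letters only: the (S3c) circle windows, the cell's flat kernel letter
# `(K, κ_b)` of `c(1)`, one rate `κ ≤ min(r, κ_b)`, and the (S3d) window `q = σ⁻¹K·e(ε_U)·K_{d+1}(κ∕4)² < 1` with `e(ε_U)` the explicit `E`-letter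
# size** — the composition of road B8″ S3 in block-entry currency: §1 (S3c) with the constant displayed → `B9Eq349GreenPerturbedBlockDecay` §1 → (S3b)
# with (S3e-Q)'s `Q`-letters and (S3e-H)'s `c_Δ` → (S3d) → (S3f); route R2′ STEP B8′, road B8″ sub-steps S3 + S4 at `U ≠ 1` of the pub-balaban NE9
# chain, instance-ledger row L9 (the sibling of `B9Eq349KWAssemblyFlat.exists_kW_DP_flat`)

statement-level skeleton of published theorems with citation tags; proofs where landed; nothing here is a claim about the Yang–Mills mass gap

CITATION HEADER (lean-in-tree rule).  Audit cell `pub-balaban`, sub-cell `t4`, BINDER row NE9; filed by NE9 formalisation-swarm LEAF PROVER 01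
(`b2b-balaban-t4-ne9-formalise-leaf-01`, gen 85), composing BY NAME: (S3c) `B9Eq349ConjugatedGreenBlockDecay.norm_conjGp_le_of_circle` ∕
`norm_block_le_exp_of_uniform_circle_bound_sites` with `B9Eq349ConjugatedDPCircleClosed.coercive_of_canonical_diagonal` (ne9-leaf-06's scalar window),
this lineage's `B9Eq349GreenPerturbedBlockDecay` §1, (S3b) `B9Eq349QGGQPerturbationLetters.norm_block_QGGQ_sub_le_torus`, (S3e-Q) `B9Eq349QtildeBlockLetters`,
(S3d) `B9Eq349PerturbedQGGQInvBlockDecay.norm_point_block_greenK_le_of_window` (over ne9-leaf-06 g68's `B9Eq349FlatQGGQInvKernel`), (S3f)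
`B9Eq349DPBlockDecayLetters.norm_bondBlock_comp_DP_comp_block_le`, (S3a) `decay_mono_rate`, (K1) `B9Eq349BlockMultipliers`, (K4b) `B9Eq349KWAssembly` §3∕§4,
`B9Thm311DeltaPrimeA.laplacePrimeA_pos_of_hRS` and `B9Eq325ProjFormula.QGGQ_pos` (the positivity witnesses), `B9Eq384RemainderLetters.hRS_one`.
ROUTE LOCUS: `t4/ROUTES-NE9.md` v13.37–v13.41 §L1.2 ADDENDUM (ii) road B8″ («S3: the ε_U-window … S4: `exists_kW_DP_strip`»; t4-ne9-idea-1 g100–g104)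
and the lineage HANDOFF § gen 84 («(K4b) §3∕§4 in the window = row L9 with a κ₁-free rate at `U ≠ 1`»).  Source READ in the held text
[Balaban1985BackgroundPropagators]: p. 399 (3.49), p. 414 (3.101) *«R(□) … can be bounded by a small factor O(M⁻¹) … together with the exponential
decay»*, (3.104), p. 416 Thm 3.11, p. 415.  Print's road is the random-walk expansion; the perturbation around the flat point in block currency is the
ROUTE's road B8″; NOTHING of print's rate `δ₀` or its constants is asserted — the rate here is `κ∕8` for the displayed letter `κ`, UNVALUED.

WHAT IS PROVED (sorry-free; proof lane — no `def`; [folklore] compositions BY NAME).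
* §1 **`norm_block_comp_GpOfU_comp_block_le_circle`** (dimension `d`, `ηL = 1`): (S3c) §4's body with the constant DISPLAYED and ANY positivity witness —
  `‖P_{y₁} ∘ G′(U) ∘ P_{y₀}‖ ≤ (4∕γ)·e^{r}·e^{−r·d_m(y₀,y₁)}`.
* §2 **`exists_block_decay_DP_window`** (dimension `d+1`): scalar letters `γ, β, r, ℓ, ℓ′` ((S3c)'s windows with `√(d+1)` and `(1+ε_R)^{(d+1)(L−1)}`),
  the flat kernel letter `hb : ‖torusKernel145M(ŷ − ŷ′)‖ ≤ K·e^{−κ_b·d_m}` for EVERY volume, `0 < κ ≤ r`, `κ ≤ κ_b`, the letters `P, s, c_Δ, C_G = 4e^{r}∕γ, e`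
  by their DEFINING EQUATIONS (`e = 2M_QC_G(β_QC_G + M_QC_Δ)K_{d+1}(κ∕2)`, `C_Δ = C_G²c_Δe^{κ}K_{d+1}(κ∕2)²`, `M_Q = Ps`, `β_Q = (P−1)s`) and the window
  `σ⁻¹·K·e·K_{d+1}(κ∕4)² < 1` ⟹ `∃ C ≥ 0, ∀ m, ∀ U` (`U ∈ U1`, `‖U − 1‖ ≤ ε_U`, `hRS`), `∀ P_S, P_B` ((K1) letters), `∀ y₀ y₁`:
  `‖P^B_{y₁} ∘ toCLM(D_U ∘ (1 − R(U))) ∘ P^S_{y₀}‖ ≤ C·e^{−(κ∕8)·d_m(y₀,y₁)}`.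
* §3 **`exists_kW_DP_window`** — §2 into (K4b) §3 `norm_sum_adad_le_lattice` and §4 `norm_sq_adjoint_le_sum_localised`: `∃ k ≥ 0` uniform in the volume
  and in `U` with the (§3-shape) and (§4-shape) conclusions of `exists_kW_DP_flat`, rate `κ∕8` — ROW L9 AT `U ≠ 1`.
HONEST SCOPE.  Composition of landed theorems; the constants are products of letters (`4∕γ`, `e^{r}`, `P`, `s`, `c_Δ`, `K`, `K_{d+1}`, `3^{d+1}`, `M_D`),
NONE evaluated; the windows are HYPOTHESES on the scalar letters (their joint satisfiability for small `ε_U` — `β_Q, c_Δ = O(ε_U)`, so `e = O(ε_U)`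
and `q < 1` is a smallness condition on `ε_U` given `K, γ, r`; the (S3c) windows hold for small `r` given `γ` — is NOT adjudicated here: the
`∃ ε₀`-first form is the sequel's); NOT print's `δ₀`; NOT NE9 (cell pub-balaban: NE9 NOT PRINTED ∕ NOT PROVED; «NE9 ⇐ the named binders»; row WALLED ON A MODEL
(O-NE9-1; #5 UNRULED); spine PROVED 0∕9; rung (B)+1 on a finite T⁴ — NOT infinite volume, NOT mass gap, NOT Clay; HONEST DEPENDENCY: continuum YM on
T⁴ ⇐ BetaPertH ∧ nine spine estimates (0/9 proved); BetaPertH ⇐ (D1) ∧ (D4) ∧ CAP+tail; G-an2-4 gates asym, D1 and NE2/3/4).  NEW file importing (S3f),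
`B9Eq349GreenPerturbedBlockDecay`, (S3c), (S3d); nothing modified.  Net new unproved facts: 0.
-/

noncomputable section

set_option autoImplicit false

open scoped InnerProductSpace ComplexConjugate BigOperators

namespace Literature.MathematicalPhysics.QuantumFieldTheory.Balaban1983to89.B9Eq349DPBlockDecayWindow

open B4Sect5Torus (TSite tdist tdist_nonneg)
open B4Sect5Proof (latticeConst latticeConst_nonneg)
open B9SectCLatticeCarrier (Bond bpos btgt)
open B9Eq311L2Pairing (WL2)
open B9Eq319QprimeTorus (fineP blockCoord)
open B11Eq103H1Complex (SiteL2K BondL2K covDerivL2K greenK)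
open B7Prop1Explicit (U1)
open B9Eq310HessianOperator (adTransportW)
open B9Eq326OperatorAssembly (QprimeW RofU)
open B9Eq3119DeltaPiCarrier (laplacePrimeA GpOfU)
open B9Eq315QTorusOnto (liftSite)
open B5Torus145Decay (torusKernel145M)
open B9Thm311DeltaPrimeA (laplacePrimeA_pos_of_hRS)
open B9Eq325ProjFormula (QGGQ_pos)
open B9Eq384RemainderLetters (hRS_one)
open B9Eq349BlockMultipliers (exists_block_clm_family sum_block_apply block_comp_self)
open B9Eq349BlockDecayAlgebra (decay_mono_rate)
open B9Eq349ConjugatedDPCircleClosed (coercive_of_canonical_diagonal)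
open B9Eq349ConjugatedGreenBlockDecay (norm_conjGp_le_of_circle norm_block_le_exp_of_uniform_circle_bound_sites)
open B9Eq349QtildeBlockLetters (point_comp_Qtilde_comp_block_eq_zero block_comp_adjoint_Qtilde_comp_point_eq_zero
  norm_point_comp_Qtilde_comp_block_le norm_point_comp_Qtilde_sub_comp_block_le norm_block_comp_adjoint_comp_point_le)
open B9Eq349QGGQPerturbationLetters (norm_block_QGGQ_sub_le_torus)
open B9Eq349GreenPerturbedBlockDecay (norm_block_comp_GpOfU_sub_flat_comp_block_le)
open B9Eq349PerturbedQGGQInvBlockDecay (norm_point_block_greenK_le_of_window)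
open B9Eq349DPBlockDecayLetters (norm_bondBlock_comp_DP_comp_block_le)
open B5TorusCover (Ctr)
open B5SmoothPartition (hS)
open B9Eq349KWAssembly (norm_sum_adad_le_lattice norm_sq_adjoint_le_sum_localised)

/-! ## §1 `G′(U)`'s block decay with the constant DISPLAYED (`4∕γ·e^{r}`, `r`) — (S3c) §4 without the `∃` -/

section Circle

variable {d : ℕ} {L : ℕ} [NeZero L] {m : Fin d → ℕ} {𝔸 : Type*} [NormedRing 𝔸] [NormedAlgebra ℂ 𝔸] [NormOneClass 𝔸]
  {W : Type*} [NormedAddCommGroup W] [InnerProductSpace ℂ W] [FiniteDimensional ℂ W] {φ : W ≃ₗ[ℂ] 𝔸} {Mφ Mφ' : ℝ}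
  (hφ : ∀ w, ‖φ w‖ ≤ Mφ * ‖w‖) (hφ' : ∀ X, ‖φ.symm X‖ ≤ Mφ' * ‖X‖) (hMφ : 0 ≤ Mφ) (hMφ' : 0 ≤ Mφ')
  {c₀ : ℝ} [Fact (0 < c₀)] {η : ℝ} (hη : 0 < η) {U : Bond d (fineP L m) → 𝔸ˣ} (hU : ∀ b, U b ∈ U1 𝔸) {εU : ℝ} (hεU : 0 ≤ εU)
  (hUε : ∀ b, ‖(U b : 𝔸) - 1‖ ≤ εU) {c₁ : ℝ} [Fact (0 < c₁)] (hc : c₁ = (L : ℝ) ^ d * c₀) {a' : ℝ} (ha' : 0 < a')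
  (hRS : ∀ (b : Bond d (fineP L m)) (v u : W), ⟪adTransportW φ U b v, u⟫_ℂ = ⟪v, adTransportW φ (fun b => (U b)⁻¹) b u⟫_ℂ)
  (hηL : η * L = 1)
  (hpos' : ∀ x : SiteL2K ℂ d (fineP L m) c₀ W, x ≠ 0 → 0 < RCLike.re ⟪x, laplacePrimeA L m φ η U a' (c₁ := c₁) x⟫_ℂ)
  {PS : TSite d m → SiteL2K ℂ d (fineP L m) c₀ W →L[ℂ] SiteL2K ℂ d (fineP L m) c₀ W}
  (hPS : ∀ (y : TSite d m) (f : SiteL2K ℂ d (fineP L m) c₀ W) (x : TSite d (fineP L m)),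
    WL2.equiv ℂ (fun _ : TSite d (fineP L m) => c₀) W (PS y f) x =
      if blockCoord L m x = y then WL2.equiv ℂ (fun _ : TSite d (fineP L m) => c₀) W f x else 0)

include hφ hφ' hMφ hMφ' hη hU hεU hUε hc ha' hRS hηL hPS in
/-- **`G′(U)`'s BLOCK DECAY, CONSTANT DISPLAYED**: (S3c) `exists_block_decay_Gp`'s body at ANY positivity witness `hpos′` — `‖P_{y₁} ∘ G′(U) ∘ P_{y₀}‖ ≤
(4∕γ)·e^{r}·e^{−r·d_m(y₀,y₁)}` in the scalar window `γ ≤ c_Δ(…ε_U)`, the radius windows and `3(1+a′)β² ≤ γ∕4`, at the diagonal `ηL = 1`; NO `κ₁`.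
[cite: Balaban1985BackgroundPropagators, (3.25) p.394, Thm 3.11 p.416, (3.49) p.399] -/
theorem norm_block_comp_GpOfU_comp_block_le_circle {γ β r : ℝ} (hγ : 0 < γ) (hβ : 0 ≤ β) (hr : 0 ≤ r)
    (hγc : γ ≤ 1 / (2 + 2 / a') -
        (Real.sqrt d * (‖((η : ℂ))⁻¹‖ * (2 * Mφ * Mφ' * εU)) + (Real.sqrt d * (‖((η : ℂ))⁻¹‖ * (2 * Mφ * Mφ' * εU))) ^ 2 +
          a' * (((1 + 2 * Mφ * Mφ' * εU) ^ (d * (L - 1)) - 1)) * (2 + ((1 + 2 * Mφ * Mφ' * εU) ^ (d * (L - 1)) - 1))))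
    {ℓ ℓ' : ℝ} (hℓ : 1 ≤ ℓ) (hℓ' : 1 ≤ ℓ') (hwin : r * ℓ * η ≤ 1) (hwin' : r * ℓ' ≤ 1)
    (hβD : 2 * r * ℓ * (Mφ * Mφ') * Real.sqrt d ≤ β) (hβQ : 2 * r * ℓ' * (1 + 2 * Mφ * Mφ' * εU) ^ (d * (L - 1)) ≤ β)
    (small : 3 * (1 + a') * β ^ 2 ≤ γ / 4) (hm : ∀ i, 1 ≤ m i) (y₀ y₁ : TSite d m) :
    ‖PS y₁ ∘L LinearMap.toContinuousLinearMap (GpOfU L m φ η U a' (c₁ := c₁) hpos') ∘L PS y₀‖ ≤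
      4 / γ * Real.exp r * Real.exp (-(r * tdist m y₀ y₁)) := by
  have hL : 1 ≤ L := Nat.one_le_iff_ne_zero.mpr (NeZero.ne L)
  have hL0 : (0 : ℝ) < L := by exact_mod_cast (show 0 < L by omega)
  have hι : 1 / (L : ℝ) ≤ ℓ * η := by
    rw [div_le_iff₀ hL0]
    calc (1 : ℝ) = 1 * (η * L) := by rw [hηL, mul_one]
      _ ≤ ℓ * (η * L) := by gcongr
      _ = ℓ * η * L := by ring
  have coercive := coercive_of_canonical_diagonal hφ hφ' hMφ hMφ' hU hεU hUε hc ha' hRS hηL hγ hγc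
  exact norm_block_le_exp_of_uniform_circle_bound_sites hm _ hPS hr (by positivity) hι hℓ'
    (fun χ χ' hχ hχ' MS hMS κ hκr => norm_conjGp_le_of_circle hφ hφ' hMφ hMφ' hη hU hεU hUε hc ha'.le hRS hpos' (zero_le_one.trans hℓ)
      (zero_le_one.trans hℓ') hχ hχ' hMS hγ hβ coercive hwin hwin' hβD hβQ small κ hκr) y₀ y₁

end Circle

/-! ## §2 The window theorem: `hτ(U)` for `T(U) = D_U(1 − R(U))` from the scalar letters, `∃ C` before the volume and the background -/

section Window

variable {d : ℕ} {L : ℕ} [NeZero L] {𝔸 : Type*} [NormedRing 𝔸] [NormedAlgebra ℂ 𝔸] [NormOneClass 𝔸]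
  {W : Type*} [NormedAddCommGroup W] [InnerProductSpace ℂ W] [FiniteDimensional ℂ W] {φ : W ≃ₗ[ℂ] 𝔸} {Mφ Mφ' : ℝ}
  (hφ : ∀ w, ‖φ w‖ ≤ Mφ * ‖w‖) (hφ' : ∀ X, ‖φ.symm X‖ ≤ Mφ' * ‖X‖) (hMφ : 0 ≤ Mφ) (hMφ' : 0 ≤ Mφ')
  {c₀ : ℝ} [Fact (0 < c₀)] {η : ℝ} (hη : 0 < η) {εU : ℝ} (hεU : 0 ≤ εU)
  {c₁ : ℝ} [Fact (0 < c₁)] (hc : c₁ = (L : ℝ) ^ (d + 1) * c₀) {a' : ℝ} (ha' : 0 < a') (hηL : η * L = 1)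

set_option maxHeartbeats 400000 in
include hφ hφ' hMφ hMφ' hη hεU hc ha' hηL in
/-- **ROW L9's `hτ` AT A GENERAL BACKGROUND OF THE WINDOW, κ₁-FREE, UNIFORM IN THE VOLUME AND IN `U`.**  Scalar letters: the (S3c) windows (`γ`, `β`, `r`,
cut-off slacks `ℓ, ℓ′ ≥ 1`), the cell's flat kernel letter `(K, κ_b)` of `c(1)` (uniform in the volume: `B9Eq349FlatQGGQInvKernel.exists_flatc_bound`'s
shape), ONE rate `0 < κ ≤ min(r, κ_b)`, and the DISPLAYED letters `P, s, c_Δ, C_G, e` (by their defining equations) with the (S3d) window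
`q = σ⁻¹K·e·K_{d+1}(κ∕4)² < 1`.  THEN `∃ C ≥ 0` such that for EVERY volume `m`, EVERY background `U` with `U(b) ∈ U1`, `‖U(b) − 1‖ ≤ ε_U` and mutually
adjoint transports, and EVERY pair of block families, `‖P^B_{y₁} ∘ D_U(1 − R(U)) ∘ P_{y₀}‖ ≤ C·e^{−(κ∕8)·d_m(y₀,y₁)}`.  Chain: §1 (`G′(U)`, `G′(1)` at `(C_G, r)`,
`C_G = 4e^{r}∕γ`) → `B9Eq349GreenPerturbedBlockDecay` §1 (`G′(U) − G′(1)` at `κ∕2`) → (S3b) `norm_block_QGGQ_sub_le_torus` with (S3e-Q)'s eight `Q`-letters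
(`hEd` at `κ∕2`) → (S3d) `norm_point_block_greenK_le_of_window` (`c(U)` at `κ∕4`) → (S3f) `norm_bondBlock_comp_DP_comp_block_le` (`T(U)` at `κ∕8`).
[cite: Balaban1985BackgroundPropagators, (3.25)–(3.26) pp.394–395, Thm 3.11 p.416, (3.49) p.399, (3.101) p.414; Balaban1984PropagatorsI, p.38] -/
theorem exists_block_decay_DP_window {γ β r ℓ ℓ' K κb κ Pw s cΔ CG e : ℝ} (hγ : 0 < γ) (hβ : 0 ≤ β) (hr : 0 ≤ r)
    (hγc : γ ≤ 1 / (2 + 2 / a') -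
        (Real.sqrt ((d + 1 : ℕ) : ℝ) * (‖((η : ℂ))⁻¹‖ * (2 * Mφ * Mφ' * εU)) + (Real.sqrt ((d + 1 : ℕ) : ℝ) * (‖((η : ℂ))⁻¹‖ * (2 * Mφ * Mφ' * εU))) ^ 2 +
          a' * (((1 + 2 * Mφ * Mφ' * εU) ^ ((d + 1) * (L - 1)) - 1)) * (2 + ((1 + 2 * Mφ * Mφ' * εU) ^ ((d + 1) * (L - 1)) - 1))))
    (hℓ : 1 ≤ ℓ) (hℓ' : 1 ≤ ℓ') (hwin : r * ℓ * η ≤ 1) (hwin' : r * ℓ' ≤ 1)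
    (hβD : 2 * r * ℓ * (Mφ * Mφ') * Real.sqrt ((d + 1 : ℕ) : ℝ) ≤ β) (hβQ : 2 * r * ℓ' * (1 + 2 * Mφ * Mφ' * εU) ^ ((d + 1) * (L - 1)) ≤ β)
    (small : 3 * (1 + a') * β ^ 2 ≤ γ / 4)
    (hK : 0 ≤ K) (hκ : 0 < κ) (hκr : κ ≤ r) (hκb : κ ≤ κb)
    (hb : ∀ (m : Fin (d + 1) → ℕ) [∀ i, NeZero (m i)] (y y' : TSite (d + 1) m),
      ‖torusKernel145M L (a' * (η * L) ^ 2 * (c₁ / (c₀ * (L : ℝ) ^ (d + 1)))) m (liftSite y - liftSite y')‖ ≤ K * Real.exp (-(κb * tdist m y y')))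
    (hPw : Pw = (1 + 2 * Mφ * Mφ' * εU) ^ ((d + 1) * (L - 1))) (hs : s = Real.sqrt (c₁ / (c₀ * (L : ℝ) ^ (d + 1))))
    (hcΔ : cΔ = 2 * (2 + 2 * Mφ * Mφ' * εU) * ‖((η : ℂ))⁻¹‖ ^ 2 * ((d + 1 : ℕ) : ℝ) * (2 * Mφ * Mφ' * εU) +
        |a'| * (((1 + 2 * Mφ * Mφ' * εU) ^ ((d + 1) * (L - 1)) + 1) * ((1 + 2 * Mφ * Mφ' * εU) ^ ((d + 1) * (L - 1)) - 1) *
          (c₁ / (c₀ * (L : ℝ) ^ (d + 1)))))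
    (hCG : CG = 4 / γ * Real.exp r)
    (he : e = 2 * (Pw * s) * CG * (((Pw - 1) * s) * CG + (Pw * s) * (CG * (cΔ * Real.exp (κ * 1)) * CG * latticeConst (d + 1) (κ - κ / 2) ^ 2)) *
      latticeConst (d + 1) (κ - κ / 2))
    (hq : (c₀ / c₁ * ((η * L) ^ 2 * (c₁ / (c₀ * (L : ℝ) ^ (d + 1)))) ^ 2 * (L : ℝ) ^ (d + 1))⁻¹ * K * e *
      latticeConst (d + 1) (κ / 2 - κ / 4) ^ 2 < 1) :
    ∃ C : ℝ, 0 ≤ C ∧ ∀ (m : Fin (d + 1) → ℕ) [∀ i, NeZero (m i)] [∀ i, NeZero (fineP L m i)]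
      (U : Bond (d + 1) (fineP L m) → 𝔸ˣ) (_hU : ∀ b, U b ∈ U1 𝔸) (_hUε : ∀ b, ‖(U b : 𝔸) - 1‖ ≤ εU)
      (_hRS : ∀ (b : Bond (d + 1) (fineP L m)) (v u : W), ⟪adTransportW φ U b v, u⟫_ℂ = ⟪v, adTransportW φ (fun b => (U b)⁻¹) b u⟫_ℂ)
      (PS : TSite (d + 1) m → SiteL2K ℂ (d + 1) (fineP L m) c₀ W →L[ℂ] SiteL2K ℂ (d + 1) (fineP L m) c₀ W)
      (_hPS : ∀ (y : TSite (d + 1) m) (f : SiteL2K ℂ (d + 1) (fineP L m) c₀ W) (x : TSite (d + 1) (fineP L m)),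
        WL2.equiv ℂ (fun _ : TSite (d + 1) (fineP L m) => c₀) W (PS y f) x =
          if blockCoord L m x = y then WL2.equiv ℂ (fun _ : TSite (d + 1) (fineP L m) => c₀) W f x else 0)
      (PB : TSite (d + 1) m → BondL2K ℂ (d + 1) (fineP L m) c₀ W →L[ℂ] BondL2K ℂ (d + 1) (fineP L m) c₀ W)
      (_hPB : ∀ (y : TSite (d + 1) m) (g : BondL2K ℂ (d + 1) (fineP L m) c₀ W) (b : Bond (d + 1) (fineP L m)),
        WL2.equiv ℂ (fun _ : Bond (d + 1) (fineP L m) => c₀) W (PB y g) b =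
          if blockCoord L m (bpos b) = y then WL2.equiv ℂ (fun _ : Bond (d + 1) (fineP L m) => c₀) W g b else 0)
      (y₀ y₁ : TSite (d + 1) m),
      ‖PB y₁ ∘L LinearMap.toContinuousLinearMap (covDerivL2K ℂ c₀ ((η : ℂ))⁻¹ (adTransportW φ U) ∘ₗ
          (LinearMap.id - RofU L m φ η U (c₀ := c₀))) ∘L PS y₀‖ ≤ C * Real.exp (-(κ / 8 * tdist m y₀ y₁)) := by
  have hc₀ : 0 < c₀ := Fact.out
  have hc₁ : 0 < c₁ := Fact.out
  have hL : 1 ≤ L := Nat.one_le_iff_ne_zero.mpr (NeZero.ne L)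
  have hLr : (0 : ℝ) < (L : ℝ) ^ (d + 1) := pow_pos (by exact_mod_cast Nat.pos_of_ne_zero (NeZero.ne L)) _
  have hεR : 0 ≤ 2 * Mφ * Mφ' * εU := by positivity
  have hPw1 : 1 ≤ Pw := by rw [hPw]; exact one_le_pow₀ (by linarith)
  have hPw0 : 0 ≤ Pw := zero_le_one.trans hPw1
  have hPsub : 0 ≤ Pw - 1 := sub_nonneg.mpr hPw1
  have hs0 : 0 ≤ s := by rw [hs]; exact Real.sqrt_nonneg _
  have hP1' : 0 ≤ (1 + 2 * Mφ * Mφ' * εU) ^ ((d + 1) * (L - 1)) - 1 := by rw [← hPw]; exact hPsub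
  have hcΔ0 : 0 ≤ cΔ := by rw [hcΔ]; positivity
  have hCG0 : 0 ≤ CG := by rw [hCG]; positivity
  have hK2 : 0 ≤ latticeConst (d + 1) (κ - κ / 2) := latticeConst_nonneg _ (by linarith)
  have hK4 : 0 ≤ latticeConst (d + 1) (κ / 2 - κ / 4) := latticeConst_nonneg _ (by linarith)
  have hK8 : 0 ≤ latticeConst (d + 1) (κ / 4 - κ / 8) := latticeConst_nonneg _ (by linarith)
  have he0 : 0 ≤ e := by rw [he]; positivity
  set σi : ℝ := (c₀ / c₁ * ((η * L) ^ 2 * (c₁ / (c₀ * (L : ℝ) ^ (d + 1)))) ^ 2 * (L : ℝ) ^ (d + 1))⁻¹ with hσi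
  have hσi0 : 0 ≤ σi := by positivity
  have hq1 : 0 < 1 - σi * K * e * latticeConst (d + 1) (κ / 2 - κ / 4) ^ 2 := sub_pos.mpr hq
  -- the constant: C_A · C_c · C_B · K_{d+1}(κ∕8)²
  set Cc : ℝ := σi * K / (1 - σi * K * e * latticeConst (d + 1) (κ / 2 - κ / 4) ^ 2) with hCc
  have hCc0 : 0 ≤ Cc := div_nonneg (mul_nonneg hσi0 hK) hq1.le
  set CT : ℝ := (2 * (1 + 2 * Mφ * Mφ' * εU) * ‖((η : ℂ))⁻¹‖ * Real.sqrt ((d + 1 : ℕ) : ℝ) * ((3 ^ (d + 1) : ℕ) : ℝ) * Real.exp (κ / 4 * 1) *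
      (CG * ((1 + 2 * Mφ * Mφ' * εU) ^ ((d + 1) * (L - 1)) * Real.sqrt (c₁ / (c₀ * (L : ℝ) ^ (d + 1)))))) * Cc *
    ((1 + 2 * Mφ * Mφ' * εU) ^ ((d + 1) * (L - 1)) * Real.sqrt (c₁ / (c₀ * (L : ℝ) ^ (d + 1))) * CG) * latticeConst (d + 1) (κ / 4 - κ / 8) ^ 2
    with hCT
  refine ⟨CT, by positivity, fun m _ _ U hU hUε hRS PS hPS PB hPB y₀ y₁ => ?_⟩
  classical
  have hm : ∀ i, 1 ≤ m i := fun i => Nat.one_le_iff_ne_zero.mpr (NeZero.ne (m i))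
  -- the coarse point family and the positivity witnesses
  obtain ⟨rr, hrr⟩ := exists_block_clm_family (𝕜 := ℂ) (w := fun _ : TSite (d + 1) m => c₁) (V := W) (fun z : TSite (d + 1) m => z)
  have hRS1 := hRS_one L m φ (𝔸 := 𝔸)
  have hposU : ∀ x : SiteL2K ℂ (d + 1) (fineP L m) c₀ W, x ≠ 0 → 0 < RCLike.re ⟪x, laplacePrimeA L m φ η U a' (c₁ := c₁) x⟫_ℂ :=
    fun x hx => laplacePrimeA_pos_of_hRS L m φ η U a' hη.ne' ha' hRS x hx
  have hpos1 : ∀ x : SiteL2K ℂ (d + 1) (fineP L m) c₀ W, x ≠ 0 →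
      0 < RCLike.re ⟪x, laplacePrimeA L m φ η (fun _ : Bond (d + 1) (fineP L m) => (1 : 𝔸ˣ)) a' (c₁ := c₁) x⟫_ℂ :=
    fun x hx => laplacePrimeA_pos_of_hRS L m φ η (fun _ : Bond (d + 1) (fineP L m) => (1 : 𝔸ˣ)) a' hη.ne' ha' hRS1 x hx
  have hXU := QGGQ_pos L m φ c₀ η U c₁ a' hRS hposU
  have hX1 := QGGQ_pos L m φ c₀ η (fun _ : Bond (d + 1) (fineP L m) => (1 : 𝔸ˣ)) c₁ a' hRS1 hpos1
  have hU1 : ∀ _b : Bond (d + 1) (fineP L m), (1 : 𝔸ˣ) ∈ U1 𝔸 := fun _ => (U1 𝔸).one_mem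
  have hUε1 : ∀ _b : Bond (d + 1) (fineP L m), ‖((1 : 𝔸ˣ) : 𝔸) - 1‖ ≤ εU := fun _ => by rw [Units.val_one, sub_self, norm_zero]; exact hεU
  -- §1: the two `G′`-letters at rate `r`, weakened to `κ` and to `κ∕4`
  have hGU : ∀ z₀ z₁, ‖PS z₁ ∘L LinearMap.toContinuousLinearMap (GpOfU L m φ η U a' (c₁ := c₁) hposU) ∘L PS z₀‖ ≤
      CG * Real.exp (-(r * tdist m z₀ z₁)) := fun z₀ z₁ => by
    rw [hCG]
    exact norm_block_comp_GpOfU_comp_block_le_circle hφ hφ' hMφ hMφ' hη hU hεU hUε hc ha' hRS hηL hposU hPS hγ hβ hr hγc hℓ hℓ' hwin hwin'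
      hβD hβQ small hm z₀ z₁
  have hG1 : ∀ z₀ z₁, ‖PS z₁ ∘L LinearMap.toContinuousLinearMap
      (GpOfU L m φ η (fun _ : Bond (d + 1) (fineP L m) => (1 : 𝔸ˣ)) a' (c₁ := c₁) hpos1) ∘L PS z₀‖ ≤ CG * Real.exp (-(r * tdist m z₀ z₁)) :=
    fun z₀ z₁ => by
    rw [hCG]
    exact norm_block_comp_GpOfU_comp_block_le_circle hφ hφ' hMφ hMφ' hη hU1 hεU hUε1 hc ha' hRS1 hηL hpos1 hPS hγ hβ hr hγc hℓ hℓ' hwin hwin'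
      hβD hβQ small hm z₀ z₁
  have hGUκ : ∀ z₀ z₁, ‖PS z₁ ∘L LinearMap.toContinuousLinearMap (GpOfU L m φ η U a' (c₁ := c₁) hposU) ∘L PS z₀‖ ≤
      CG * Real.exp (-(κ * tdist m z₀ z₁)) := fun z₀ z₁ => decay_mono_rate hCG0 hκr (tdist_nonneg m z₀ z₁) (hGU z₀ z₁)
  have hG1κ : ∀ z₀ z₁, ‖PS z₁ ∘L LinearMap.toContinuousLinearMap
      (GpOfU L m φ η (fun _ : Bond (d + 1) (fineP L m) => (1 : 𝔸ˣ)) a' (c₁ := c₁) hpos1) ∘L PS z₀‖ ≤ CG * Real.exp (-(κ * tdist m z₀ z₁)) :=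
    fun z₀ z₁ => decay_mono_rate hCG0 hκr (tdist_nonneg m z₀ z₁) (hG1 z₀ z₁)
  have hGU4 : ∀ z₀ z₁, ‖PS z₁ ∘L LinearMap.toContinuousLinearMap (GpOfU L m φ η U a' (c₁ := c₁) hposU) ∘L PS z₀‖ ≤
      CG * Real.exp (-(κ / 4 * tdist m z₀ z₁)) := fun z₀ z₁ => decay_mono_rate hCG0 (by linarith) (tdist_nonneg m z₀ z₁) (hGUκ z₀ z₁)
  -- `G′(U) − G′(1)` at rate `κ∕2` (B9Eq349GreenPerturbedBlockDecay §1)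
  have hΔd := norm_block_comp_GpOfU_sub_flat_comp_block_le hPS hφ hφ' hMφ hMφ' hU hεU hUε hRS hm hposU hpos1 hCG0 (by linarith : 0 ≤ κ / 2)
    (by linarith : κ / 2 < κ) hGUκ hG1κ
  -- the `E`-letter `hEd` at rate `κ∕2` ((S3b) with (S3e-Q)'s eight `Q`-letters)
  have hEd := norm_block_QGGQ_sub_le_torus hm PS (sum_block_apply hPS) (block_comp_self hPS) rr
    (LinearMap.toContinuousLinearMap ((WL2.linearEquiv ℂ ℂ (fun _ : TSite (d + 1) m => c₁)).symm.toLinearMap ∘ₗ QprimeW L m φ U (c₀ := c₀)))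
    (LinearMap.toContinuousLinearMap ((WL2.linearEquiv ℂ ℂ (fun _ : TSite (d + 1) m => c₁)).symm.toLinearMap ∘ₗ
      QprimeW L m φ (fun _ : Bond (d + 1) (fineP L m) => (1 : 𝔸ˣ)) (c₀ := c₀)))
    (ContinuousLinearMap.adjoint (LinearMap.toContinuousLinearMap
      ((WL2.linearEquiv ℂ ℂ (fun _ : TSite (d + 1) m => c₁)).symm.toLinearMap ∘ₗ QprimeW L m φ U (c₀ := c₀))))
    (ContinuousLinearMap.adjoint (LinearMap.toContinuousLinearMap
      ((WL2.linearEquiv ℂ ℂ (fun _ : TSite (d + 1) m => c₁)).symm.toLinearMap ∘ₗ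
        QprimeW L m φ (fun _ : Bond (d + 1) (fineP L m) => (1 : 𝔸ˣ)) (c₀ := c₀))))
    (LinearMap.toContinuousLinearMap (GpOfU L m φ η U a' (c₁ := c₁) hposU))
    (LinearMap.toContinuousLinearMap (GpOfU L m φ η (fun _ : Bond (d + 1) (fineP L m) => (1 : 𝔸ˣ)) a' (c₁ := c₁) hpos1))
    (MQ := Pw * s) (βQ := (Pw - 1) * s) (by positivity) (by positivity) hCG0 (by positivity : 0 ≤ CG * (cΔ * Real.exp (κ * 1)) * CG *
      latticeConst (d + 1) (κ - κ / 2) ^ 2) (by linarith : 0 ≤ κ / 2) (by linarith : κ / 2 < κ)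
    (fun z y hz => point_comp_Qtilde_comp_block_eq_zero hrr hPS U (Ne.symm hz))
    (fun z y hz => point_comp_Qtilde_comp_block_eq_zero hrr hPS _ (Ne.symm hz))
    (fun y => by rw [hPw, hs]; exact norm_point_comp_Qtilde_comp_block_le hrr hPS hφ hφ' hMφ hMφ' hU1 hεU hUε1 y y)
    (fun y => by rw [hPw, hs]; exact norm_point_comp_Qtilde_sub_comp_block_le hrr hPS hφ hφ' hMφ hMφ' hU hεU hUε y y)
    (fun y z hz => block_comp_adjoint_Qtilde_comp_point_eq_zero hrr hPS U (Ne.symm hz))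
    (fun y z hz => block_comp_adjoint_Qtilde_comp_point_eq_zero hrr hPS _ (Ne.symm hz))
    (fun y => norm_block_comp_adjoint_comp_point_le hrr hPS _ y y
      (by rw [hPw, hs]; exact norm_point_comp_Qtilde_comp_block_le hrr hPS hφ hφ' hMφ hMφ' hU hεU hUε y y))
    (fun y => by
      rw [← map_sub]
      exact norm_block_comp_adjoint_comp_point_le hrr hPS _ y y
        (by rw [hPw, hs]; exact norm_point_comp_Qtilde_sub_comp_block_le hrr hPS hφ hφ' hMφ hMφ' hU hεU hUε y y))
    hGUκ hG1κ (fun z₀ z₁ => by rw [hcΔ]; exact hΔd z₀ z₁)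
  -- the flat kernel letter at `κ∕2`, then (S3d): `c(U)` at `κ∕4`
  have hb2 : ∀ y y' : TSite (d + 1) m, ‖torusKernel145M L (a' * (η * L) ^ 2 * (c₁ / (c₀ * (L : ℝ) ^ (d + 1)))) m (liftSite y - liftSite y')‖ ≤
      K * Real.exp (-(κ / 2 * tdist m y y')) := fun y y' => decay_mono_rate hK (by linarith) (tdist_nonneg m y y') (hb m y y')
  have hcd := norm_point_block_greenK_le_of_window L m φ c₀ η c₁ hη.ne' ha' U hpos1 hX1 hposU hXU hrr hK he0 (by linarith : 0 ≤ κ / 4)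
    (by linarith : κ / 4 < κ / 2) hb2 (fun z₀ z₁ => by
      rw [he]
      have h := hEd z₀ z₁
      exact le_of_eq_of_le (by congr 1) h) hq
  -- (S3f): `T(U)` at `κ∕8`
  exact norm_bondBlock_comp_DP_comp_block_le hPS hPB hrr hφ hφ' hMφ hMφ' hU hεU hUε hRS hposU hm hXU hCG0 hCc0 (by linarith : 0 ≤ κ / 8)
    (by linarith : κ / 8 < κ / 4) hGU4 hcd y₀ y₁


/-! ## §3 Row L9 at a general background: (K4b) §3∕§4 fed by §2 — the sibling of `B9Eq349KWAssemblyFlat.exists_kW_DP_flat` -/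

include hφ hφ' hMφ hMφ' hη hεU hc ha' hηL in
/-- **ROW L9 (`k_W`, `b_W`) FOR `T(U) = D_U(1 − R(U))` AT EVERY BACKGROUND OF THE WINDOW, κ₁-FREE, UNIFORM IN THE VOLUME**: under §2's scalar letters
and windows, `∃ k ≥ 0` such that for every volume `m`, every `U` (`U ∈ U1`, `‖U − 1‖ ≤ ε_U`, `hRS`), every `T` with the propositional let `T = D_U(1 − R(U))`,
every partition scale `M₀` and cut-off families `χ_S^z, χ_B^z` realising the tree's `h_z`: (§3-shape of (K4b)) `‖(Σ_z ad_z ad_z T) x‖ ≤ 4·(2·7^{d+1})·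
((4(d+1)L∕M₀)²·k·((16∕(κ∕8)² + 2)·K_{d+1}(κ∕16)))·‖x‖`, AND (§4-shape, given `M₀ ∣ LN_i` and a size letter `‖Tx‖ ≤ C_W‖x‖`) the (up) row for `W = T†`.
[folklore] (composition) [cite: Balaban1985BackgroundPropagators, (3.101) p.414 «small factor O(M⁻¹) … together with the exponential decay», (3.104) p.414, (3.49) p.399, (3.26) p.395] -/
theorem exists_kW_DP_window {γ β r ℓ ℓ' K κb κ Pw s cΔ CG e : ℝ} (hγ : 0 < γ) (hβ : 0 ≤ β) (hr : 0 ≤ r)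
    (hγc : γ ≤ 1 / (2 + 2 / a') -
        (Real.sqrt ((d + 1 : ℕ) : ℝ) * (‖((η : ℂ))⁻¹‖ * (2 * Mφ * Mφ' * εU)) + (Real.sqrt ((d + 1 : ℕ) : ℝ) * (‖((η : ℂ))⁻¹‖ * (2 * Mφ * Mφ' * εU))) ^ 2 +
          a' * (((1 + 2 * Mφ * Mφ' * εU) ^ ((d + 1) * (L - 1)) - 1)) * (2 + ((1 + 2 * Mφ * Mφ' * εU) ^ ((d + 1) * (L - 1)) - 1))))
    (hℓ : 1 ≤ ℓ) (hℓ' : 1 ≤ ℓ') (hwin : r * ℓ * η ≤ 1) (hwin' : r * ℓ' ≤ 1)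
    (hβD : 2 * r * ℓ * (Mφ * Mφ') * Real.sqrt ((d + 1 : ℕ) : ℝ) ≤ β) (hβQ : 2 * r * ℓ' * (1 + 2 * Mφ * Mφ' * εU) ^ ((d + 1) * (L - 1)) ≤ β)
    (small : 3 * (1 + a') * β ^ 2 ≤ γ / 4)
    (hK : 0 ≤ K) (hκ : 0 < κ) (hκr : κ ≤ r) (hκb : κ ≤ κb)
    (hb : ∀ (m : Fin (d + 1) → ℕ) [∀ i, NeZero (m i)] (y y' : TSite (d + 1) m),
      ‖torusKernel145M L (a' * (η * L) ^ 2 * (c₁ / (c₀ * (L : ℝ) ^ (d + 1)))) m (liftSite y - liftSite y')‖ ≤ K * Real.exp (-(κb * tdist m y y')))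
    (hPw : Pw = (1 + 2 * Mφ * Mφ' * εU) ^ ((d + 1) * (L - 1))) (hs : s = Real.sqrt (c₁ / (c₀ * (L : ℝ) ^ (d + 1))))
    (hcΔ : cΔ = 2 * (2 + 2 * Mφ * Mφ' * εU) * ‖((η : ℂ))⁻¹‖ ^ 2 * ((d + 1 : ℕ) : ℝ) * (2 * Mφ * Mφ' * εU) +
        |a'| * (((1 + 2 * Mφ * Mφ' * εU) ^ ((d + 1) * (L - 1)) + 1) * ((1 + 2 * Mφ * Mφ' * εU) ^ ((d + 1) * (L - 1)) - 1) *
          (c₁ / (c₀ * (L : ℝ) ^ (d + 1)))))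
    (hCG : CG = 4 / γ * Real.exp r)
    (he : e = 2 * (Pw * s) * CG * (((Pw - 1) * s) * CG + (Pw * s) * (CG * (cΔ * Real.exp (κ * 1)) * CG * latticeConst (d + 1) (κ - κ / 2) ^ 2)) *
      latticeConst (d + 1) (κ - κ / 2))
    (hq : (c₀ / c₁ * ((η * L) ^ 2 * (c₁ / (c₀ * (L : ℝ) ^ (d + 1)))) ^ 2 * (L : ℝ) ^ (d + 1))⁻¹ * K * e *
      latticeConst (d + 1) (κ / 2 - κ / 4) ^ 2 < 1) :
    ∃ k : ℝ, 0 ≤ k ∧ ∀ (m : Fin (d + 1) → ℕ) [∀ i, NeZero (m i)] [∀ i, NeZero (fineP L m i)]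
      (U : Bond (d + 1) (fineP L m) → 𝔸ˣ) (_hU : ∀ b, U b ∈ U1 𝔸) (_hUε : ∀ b, ‖(U b : 𝔸) - 1‖ ≤ εU)
      (_hRS : ∀ (b : Bond (d + 1) (fineP L m)) (v u : W), ⟪adTransportW φ U b v, u⟫_ℂ = ⟪v, adTransportW φ (fun b => (U b)⁻¹) b u⟫_ℂ)
      (T : SiteL2K ℂ (d + 1) (fineP L m) c₀ W →L[ℂ] BondL2K ℂ (d + 1) (fineP L m) c₀ W)
      (_hT : T = LinearMap.toContinuousLinearMap (covDerivL2K ℂ c₀ ((η : ℂ))⁻¹ (adTransportW φ U) ∘ₗ (LinearMap.id - RofU L m φ η U (c₀ := c₀))))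
      (M₀ : ℕ) (_hM : 1 ≤ M₀) (_hLM : L ≤ M₀) (_h2N : ∀ i, 2 * M₀ ≤ fineP L m i)
      (χS : Ctr (fineP L m) M₀ → SiteL2K ℂ (d + 1) (fineP L m) c₀ W →L[ℂ] SiteL2K ℂ (d + 1) (fineP L m) c₀ W)
      (χB : Ctr (fineP L m) M₀ → BondL2K ℂ (d + 1) (fineP L m) c₀ W →L[ℂ] BondL2K ℂ (d + 1) (fineP L m) c₀ W)
      (_hχS : ∀ (z : Ctr (fineP L m) M₀) (f : SiteL2K ℂ (d + 1) (fineP L m) c₀ W) (x : TSite (d + 1) (fineP L m)),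
        WL2.equiv ℂ (fun _ : TSite (d + 1) (fineP L m) => c₀) W (χS z f) x =
          (hS (fineP L m) M₀ z x : ℂ) • WL2.equiv ℂ (fun _ : TSite (d + 1) (fineP L m) => c₀) W f x)
      (_hχB : ∀ (z : Ctr (fineP L m) M₀) (g : BondL2K ℂ (d + 1) (fineP L m) c₀ W) (b : Bond (d + 1) (fineP L m)),
        WL2.equiv ℂ (fun _ : Bond (d + 1) (fineP L m) => c₀) W (χB z g) b =
          (hS (fineP L m) M₀ z (bpos b) : ℂ) • WL2.equiv ℂ (fun _ : Bond (d + 1) (fineP L m) => c₀) W g b),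
      (∀ x : SiteL2K ℂ (d + 1) (fineP L m) c₀ W,
        ‖(∑ z : Ctr (fineP L m) M₀, (χB z ∘L (χB z ∘L T - T ∘L χS z) - (χB z ∘L T - T ∘L χS z) ∘L χS z)) x‖ ≤
          4 * ((2 * 7 ^ (d + 1) : ℕ) : ℝ) * ((4 * ((d + 1 : ℕ) : ℝ) * L / M₀) ^ 2 * k * ((16 / (κ / 8) ^ 2 + 2) * latticeConst (d + 1) ((κ / 8) / 2))) * ‖x‖) ∧
      (∀ (_hdiv : ∀ i, M₀ ∣ fineP L m i) {CW : ℝ} (_hCW : 0 ≤ CW) (_hTW : ∀ x, ‖T x‖ ≤ CW * ‖x‖) (g : BondL2K ℂ (d + 1) (fineP L m) c₀ W),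
        ‖ContinuousLinearMap.adjoint T g‖ ^ 2 ≤ ∑ z : Ctr (fineP L m) M₀, ‖ContinuousLinearMap.adjoint T (χB z g)‖ ^ 2 +
          CW * (4 * ((2 * 7 ^ (d + 1) : ℕ) : ℝ) * ((4 * ((d + 1 : ℕ) : ℝ) * L / M₀) ^ 2 * k * ((16 / (κ / 8) ^ 2 + 2) * latticeConst (d + 1) ((κ / 8) / 2)))) *
            ‖g‖ ^ 2) := by
  obtain ⟨k, hk, hτ⟩ := exists_block_decay_DP_window hφ hφ' hMφ hMφ' hη hεU hc ha' hηL hγ hβ hr hγc hℓ hℓ' hwin hwin' hβD hβQ small hK hκ hκr hκb hb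
    hPw hs hcΔ hCG he hq
  refine ⟨k, hk, fun m _ _ U hU hUε hRS T hT1 M₀ hM hLM h2N χS χB hχS hχB => ?_⟩
  have hm : ∀ i, 1 ≤ m i := fun i => Nat.one_le_iff_ne_zero.mpr (NeZero.ne (m i))
  subst hT1
  have hτU := hτ m U hU hUε hRS
  have hκ8 : 0 < κ / 8 := by positivity
  have hdd : ((d + 1 : ℕ) : ℝ) = (d : ℝ) + 1 := by push_cast; ring
  refine ⟨fun x => ?_, fun hdiv CW hCW hTW g => ?_⟩
  · have h := norm_sum_adad_le_lattice hm hM hLM h2N _ χS χB hχS hχB hk hκ8 hτU x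
    simpa only [hdd] using h
  · have h := norm_sq_adjoint_le_sum_localised hm hM hLM hdiv h2N _ χS χB hχS hχB hk hκ8 hτU hCW hTW g
    simpa only [hdd] using h

end Window

end Literature.MathematicalPhysics.QuantumFieldTheory.Balaban1983to89.B9Eq349DPBlockDecayWindow

end
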